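import Mathlib
import Literature.AlgebraicGeometry.HodgeTheory.AlgebraicCyclesDefinedOverQbarSpread
import Literature.AlgebraicGeometry.HodgeTheory.AlgebraicCyclesDefinedOverQbarParameter
import Literature.AlgebraicGeometry.HodgeTheory.AlgebraicCyclesDefinedOverQbar
import Literature.AlgebraicGeometry.Motives.SubschemeCyclesDimProofs
import Literature.AlgebraicGeometry.Motives.CyclesDimensionProofs
import Literature.AlgebraicGeometry.Motives.AlgebraicEquivalenceFamilyFiber
import Literature.AlgebraicGeometry.Motives.SteinFactorizationCurve
import Literature.AlgebraicGeometry.Motives.ClosedSubvarietyOfPoint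
import Literature.AlgebraicGeometry.Motives.BettiCycleClassProofs
import Literature.AlgebraicGeometry.Resolution.ProjectiveResolutionProofs
import HarnessLib

/-!
# Algebraic classes are supported on ℚ̄-closed subsets — III: the family, and the discharge

Final file of the proof of the named fact
`charlesSchnell2014_algebraicClasses_supportedOn_qbarClosed` (`AlgebraicCyclesDefinedOverQbar.lean`;
Charles–Schnell, *Notes on absolute Hodge classes*, Remark after Cor. 11.3.16, with Fulton,
*Intersection Theory*, §19.1 and Example 19.1.10). The target file reduces the fact to the
existence, for `X = X₀ ⊗_σ ℂ` and an irreducible closed `V ⊆ X` of codimension `p`, of a SPREAD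
CLASS: a smooth projective `T₀/ℚ̄`, a `ℚ̄`-closed `𝒱₀ ⊆ X₀ ⊗ T₀`, a complex point `t` of `T₀ ⊗ ℂ`
with `𝒱_t ⊆ V`, a class `κ` on `X ⊗ T` dying off `𝒱 = 𝒱₀ ⊗ ℂ` with `i_t^* κ ≠ 0`, and an open
`U₀ ⊆ T₀` of `ℚ̄`-points with slices of codimension `≥ p`
(`charlesSchnell2014_algebraicClasses_supportedOn_qbarClosed_of_spreadClass`), and proves the
existence of `κ` from a resolved family (`exists_spreadClass_of_resolution`). Here we construct the
geometry and conclude: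

* restriction of cartesian squares over opens of the base (`exists_isPullback_morphismRestrict`)
  and the dimension bound for points of a fibre over a rational point of the smooth locus
  (`height_le_of_smoothOfRelativeDimension_morphismRestrict`: additivity of transcendence degrees,
  no flatness needed);
* density of the good part of the fibre over a generic `L`-point
  (`range_subset_closure_inter_preimage`: the fibre is a base change of the generic fibre along a
  universally open morphism of field spectra) and irreducibility of that fibre
  (`isIrreducible_preimage_range_sliceAt`);
* the resolved family over `ℚ̄` (`exists_resolvedFamily`: Hironaka for `closure {ζ} ⊆ X₀ ⊗ T₀`,
  birationality as a closed immersion over an open `O ∋ ζ`, generic smoothness of `W₀ → T₀` in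
  characteristic zero);
* the complex side (`exists_spreadClass_of_groundFamily`): the fibre of `W = W₀ ⊗ ℂ → T` over the
  generic slice is smooth projective irreducible of dimension `q`, of codimension `d`, immersive into
  `X` at a complex point, so `exists_spreadClass_of_resolution` applies; and the codimension of
  the special `ℚ̄`-slices over the smooth locus (`forall_le_coheight_of_sliceAt_mem_range`);
* the assembly `spreadClass_exists` (with the generic parameter of
  `AlgebraicCyclesDefinedOverQbarParameter`) and the discharge
  `charlesSchnell2014_algebraicClasses_supportedOn_qbarClosed_holds`.

## References
* F. Charles, C. Schnell, *Notes on absolute Hodge classes*, in: Hodge Theory (Cattani et al.,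
  eds.), Princeton 2014, §11.3, Remark after Cor. 11.3.16.
* W. Fulton, *Intersection Theory*, 2nd ed., Springer 1998, §10.1, §19.1, Example 19.1.10.
* R. Hartshorne, *Algebraic Geometry*, II Ex. 3.20, 3.22; III Prop. 9.5, Cor. 10.7.
* J. Kollár, *Lectures on Resolution of Singularities*, 2007, Thm. 3.27.
* U. Görtz, T. Wedhorn, *Algebraic Geometry I*, 2nd ed., 2020, Prop. 14.57.
* The Stacks Project, Tags 0383, 02JW.
-/

noncomputable section

open CategoryTheory CategoryTheory.Limits AlgebraicGeometry
open MonoidalCategory CartesianMonoidalCategory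

namespace Literature.AlgebraicGeometry.HodgeTheory

open Literature.AlgebraicGeometry.Motives

universe u

/-! ### Restricting a cartesian square over an open of the base -/

section RestrictSquare

/-- **A cartesian square restricts over an open of its base corner**: if `t, l, r, b` form a
cartesian square (`t ≫ r = l ≫ b`) and `U` is open in the target of `r` and `b`, then
`l ∣_ b⁻¹U` is a base change of `r ∣_ U` along `b ∣_ U` (pasting with Mathlib's
`isPullback_morphismRestrict`). [folklore] -/
theorem exists_isPullback_morphismRestrict {P X Y S : Scheme.{u}} {t : P ⟶ X} {l : P ⟶ Y}
    {r : X ⟶ S} {b : Y ⟶ S} (H : IsPullback t l r b) (U : S.Opens) :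
    ∃ t' : ↑(l ⁻¹ᵁ (b ⁻¹ᵁ U)) ⟶ ↑(r ⁻¹ᵁ U), t' ≫ (r ⁻¹ᵁ U).ι = (l ⁻¹ᵁ (b ⁻¹ᵁ U)).ι ≫ t ∧
      IsPullback t' (l ∣_ (b ⁻¹ᵁ U)) (r ∣_ U) (b ∣_ U) := by
  have A := (isPullback_morphismRestrict l (b ⁻¹ᵁ U)).flip
  have s₀ := A.paste_horiz H
  -- bottom: `(b⁻¹U).ι ≫ b = (b ∣_ U) ≫ U.ι`
  rw [← morphismRestrict_ι] at s₀
  have tq := (isPullback_morphismRestrict r U).flip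
  exact ⟨_, tq.lift_fst _ _ _, IsPullback.of_right' s₀ tq⟩

/-- A property of morphisms stable under base change passes from `r ∣_ U` to `l ∣_ b⁻¹U` in a
cartesian square `t ≫ r = l ≫ b`. [folklore] -/
theorem morphismRestrict_of_isPullback {W : MorphismProperty Scheme.{u}}
    [W.IsStableUnderBaseChange] {P X Y S : Scheme.{u}} {t : P ⟶ X} {l : P ⟶ Y} {r : X ⟶ S}
    {b : Y ⟶ S} (H : IsPullback t l r b) (U : S.Opens) (h : W (r ∣_ U)) :
    W (l ∣_ (b ⁻¹ᵁ U)) := by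
  obtain ⟨t', -, H'⟩ := exists_isPullback_morphismRestrict H U
  exact MorphismProperty.of_isPullback H' h

/-- In a cartesian square `t ≫ r = l ≫ b`, if `r` is an isomorphism over the open `U` then `l` is
an isomorphism over `b⁻¹U`. [folklore] -/
theorem isIso_morphismRestrict_of_isPullback {P X Y S : Scheme.{u}} {t : P ⟶ X} {l : P ⟶ Y}
    {r : X ⟶ S} {b : Y ⟶ S} (H : IsPullback t l r b) (U : S.Opens) [IsIso (r ∣_ U)] :
    IsIso (l ∣_ (b ⁻¹ᵁ U)) :=
  (MorphismProperty.isomorphisms.iff _).mp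
    (morphismRestrict_of_isPullback (W := MorphismProperty.isomorphisms Scheme.{u}) H U
      ((MorphismProperty.isomorphisms.iff _).mpr ‹_›))

end RestrictSquare

/-! ### Points of a fibre over a rational point of the smooth locus have bounded dimension -/

section FibreHeight

variable {k : Type u} [Field k]

/-- **Fibre smoothness over a point of the smooth locus**: if `f ∣_ V` is smooth of relative
dimension `q` and `f x ∈ V`, the scheme-theoretic fibre of `f` through `x` is smooth of relative
dimension `q` over `κ(f x)` (base change). [folklore] -/
theorem smoothOfRelativeDimension_fiberToSpecResidueField {X S : Scheme.{u}} (f : X ⟶ S)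
    (V : S.Opens) {q : ℕ} [SmoothOfRelativeDimension q (f ∣_ V)] {s : S} (hs : s ∈ V) :
    SmoothOfRelativeDimension q (f.fiberToSpecResidueField s) := by
  have sq : IsPullback (f.fiberι s) (f.fiberToSpecResidueField s) f (S.fromSpecResidueField s) :=
    IsPullback.of_hasPullback f (S.fromSpecResidueField s)
  have hrange : Set.range (S.fromSpecResidueField s).base ⊆ Set.range V.ι.base := by
    rw [Scheme.range_fromSpecResidueField, Scheme.Opens.range_ι, Set.singleton_subset_iff]
    exact hs
  set c := IsOpenImmersion.lift V.ι (S.fromSpecResidueField s) hrange with hc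
  have hcf : c ≫ V.ι = S.fromSpecResidueField s := IsOpenImmersion.lift_fac _ _ _
  rw [← hcf] at sq
  have tq := (isPullback_morphismRestrict f V).flip
  have H := IsPullback.of_right' sq tq
  haveI := smoothOfRelativeDimension_isStableUnderBaseChange (n := q)
  exact MorphismProperty.of_isPullback H ‹_›

/-- **Points of the fibre over a rational point of the smooth locus have dimension `≤ q`.** For a
morphism `f : Y ⟶ S` of `k`-schemes locally of finite type, an open `V ⊆ S` with `f ∣_ V` smooth of
relative dimension `q`, and a rational point `s ∈ S(k)` in `V`, every `y ∈ Y` over `s` has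
`dim closure {y} ≤ q`: `dim {y}⁻ = dim {s}⁻ + dim_{Y_s} {y}⁻` (additivity of transcendence
degrees, `Motives.height_eq_height_add_height_asFiber`), `dim {s}⁻ = 0` for a rational point, and
the fibre `Y_s` is smooth of dimension `q`. [cite: Hartshorne1977, II Ex. 3.20 and III Thm. 10.2]
[cite: StacksProject, Tag 02JW] -/
theorem height_le_of_smoothOfRelativeDimension_morphismRestrict {Y S : SchemeOver k}
    [LocallyOfFiniteType Y.hom] [LocallyOfFiniteType S.hom] (f : Y ⟶ S) (V : S.left.Opens)
    {q : ℕ} [SmoothOfRelativeDimension q (f.left ∣_ V)] (s : AlgPoints S k) (hs : s.pt ∈ V)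
    {y : Y.left} (hy : f.left.base y = s.pt) : Order.height y ≤ q := by
  haveI : LocallyOfFiniteType f.left := by
    have hc : f.left ≫ S.hom = Y.hom := Over.w f
    haveI : LocallyOfFiniteType (f.left ≫ S.hom) := by rw [hc]; infer_instance
    exact locallyOfFiniteType_of_comp f.left S.hom
  have hadd := Motives.Scheme.height_eq_height_add_height_asFiber f.left S.hom y
  have h0 : Order.height (f.left.base y) = 0 := by
    rw [hy]
    exact AlgPoints.height_apply_eq_zero S s
  rw [h0, zero_add] at hadd
  rw [hadd]
  -- the fibre through `y` is smooth of relative dimension `q` over `κ(s)`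
  have hyV : f.left y ∈ V := by
    rw [hy]
    exact hs
  have hsm : SmoothOfRelativeDimension q (f.left.fiberToSpecResidueField (f.left y)) :=
    smoothOfRelativeDimension_fiberToSpecResidueField f.left V (q := q) hyV
  have hne : Nonempty ↥(f.left.fiber (f.left y)) := ⟨f.left.asFiber y⟩
  have hk := @Motives.krullDim_eq_of_smoothOfRelativeDimension _ _ _
    (f.left.fiberToSpecResidueField (f.left y)) q hsm hne
  have hle := Order.height_le_krullDim (f.left.asFiber y)
  rw [hk] at hle
  exact_mod_cast hle

end FibreHeight

/-! ### Density in the fibre over a generic `L`-point of the part over a dense open -/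

section Density

variable {K L : Type u} [Field K] [Field L] (σ : K →+* L)

/-- **The fibre over a generic point meets a prescribed open densely.** Let `h₀ : W₀ ⟶ T₀` be a
dominant morphism of integral `K`-schemes, `τ : Spec L ⟶ T₀` a morphism onto the generic point,
and `i : F ⟶ W₀ ⊗_σ L`, `p : F ⟶ Spec L` with `(i ≫ π_{W₀}, p)` exhibiting `F = W₀ ×_{T₀} Spec L`
(e.g. the fibre of `h₀ ⊗_σ L` over an `L`-point of `T₀ ⊗_σ L` above the generic point). Then for
every non-empty open `A₀ ⊆ W₀`, the points of `i(F)` projecting into `A₀` are dense in `i(F)`.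
Indeed `F → (W₀)_{η} = W₀ ×_{T₀} Spec κ(η)` is a base change of `Spec L → Spec κ(η)`, hence open
(Mathlib: morphisms to the spectrum of a field are universally open), and every non-empty open of
the generic fibre contains its generic point, which projects to the generic point of `W₀ ∈ A₀`.
[cite: GortzWedhorn2020, Prop. 14.57 (p. 571) and Lemma 14.8] [cite: StacksProject, Tag 0383] -/
theorem range_subset_closure_inter_preimage {W₀ T₀ : SchemeOver K} [IsIntegral W₀.left]
    [IsIntegral T₀.left] (h₀ : W₀ ⟶ T₀)
    (hdom : h₀.left.base (genericPoint W₀.left) = genericPoint T₀.left)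
    {F : Scheme.{u}} (i : F ⟶ ((baseChangeHom σ).obj W₀).left) (p : F ⟶ Spec (.of L))
    (τ : Spec (.of L) ⟶ T₀.left) (hτ : τ.base (IsLocalRing.closedPoint L) = genericPoint T₀.left)
    (H : IsPullback (i ≫ baseChangeHomFst σ W₀) p h₀.left τ)
    (A₀ : W₀.left.Opens) (hA₀ : (A₀ : Set W₀.left).Nonempty) :
    Set.range i.base ⊆
      closure (Set.range i.base ∩ (baseChangeHomFst σ W₀).base ⁻¹' (A₀ : Set W₀.left)) := by
  -- factor `τ` through the residue field of the generic point
  set η := τ.base (IsLocalRing.closedPoint L) with hη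
  set φ := T₀.left.descResidueField (Scheme.stalkClosedPointTo τ) with hφ
  have hτfac : Spec.map φ ≫ T₀.left.fromSpecResidueField η = τ :=
    Scheme.descResidueField_stalkClosedPointTo_fromSpecResidueField L T₀.left τ
  -- `F → (W₀)_η` as a base change of `Spec L → Spec κ(η)`
  have fsq : IsPullback (h₀.left.fiberι η) (h₀.left.fiberToSpecResidueField η) h₀.left
      (T₀.left.fromSpecResidueField η) :=
    IsPullback.of_hasPullback h₀.left (T₀.left.fromSpecResidueField η)
  rw [← hτfac] at H
  have Hq := IsPullback.of_right' H fsq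
  set q₁ := fsq.lift (i ≫ baseChangeHomFst σ W₀) (p ≫ Spec.map φ) (by rw [H.w, Category.assoc])
    with hq₁
  have hq₁ι : q₁ ≫ h₀.left.fiberι η = i ≫ baseChangeHomFst σ W₀ := fsq.lift_fst _ _ _
  haveI : UniversallyOpen (Spec.map φ) := inferInstance
  haveI : UniversallyOpen q₁ := MorphismProperty.of_isPullback Hq.flip inferInstance
  have hopen : IsOpenMap q₁.base := q₁.isOpenMap
  -- the generic point of the generic fibre
  have hωη : h₀.left.base (genericPoint W₀.left) ∈ ({η} : Set T₀.left) := by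
    rw [Set.mem_singleton_iff, hdom, ← hτ]
  obtain ⟨ω', hω'⟩ : genericPoint W₀.left ∈ Set.range (h₀.left.fiberι η).base := by
    rw [Scheme.Hom.range_fiberι]; exact hωη
  have hgen : ∀ (O' : Set ↥(h₀.left.fiber η)), IsOpen O' → O'.Nonempty → ω' ∈ O' := by
    intro O' hO' ⟨y, hy⟩
    have hsp : ω' ⤳ y := by
      rw [← (h₀.left.fiberι η).isEmbedding.isInducing.specializes_iff, hω']
      exact genericPoint_specializes _
    exact hsp.mem_open hO' hy
  have hωA : genericPoint W₀.left ∈ (A₀ : Set W₀.left) :=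
    ((genericPoint_spec W₀.left).mem_open_set_iff A₀.2).2 (by simpa using hA₀)
  -- density
  rintro _ ⟨f₀, rfl⟩
  rw [mem_closure_iff]
  intro O hO hf₀
  have hO' : (q₁.base '' (i.base ⁻¹' O)).Nonempty := ⟨_, f₀, hf₀, rfl⟩
  obtain ⟨f₁, hf₁, hqf₁⟩ := hgen _ (hopen _ (hO.preimage i.base.hom.continuous)) hO'
  refine ⟨i.base f₁, hf₁, Set.mem_range_self _, ?_⟩
  change (i ≫ baseChangeHomFst σ W₀).base f₁ ∈ (A₀ : Set W₀.left)
  rw [← hq₁ι, Scheme.Hom.comp_base, TopCat.coe_comp, Function.comp_apply, hqf₁, hω']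
  exact hωA

end Density

/-! ### Irreducibility of the fibre of the resolution over the generic slice -/

section Irreducible

/-- A set squeezed between a preirreducible set and its closure is preirreducible. [folklore] -/
theorem isPreirreducible_of_subset_of_subset_closure {α : Type*} [TopologicalSpace α]
    {s S : Set α} (hs : IsPreirreducible s) (h₁ : s ⊆ S) (h₂ : S ⊆ closure s) :
    IsPreirreducible S := by
  rintro u v hu hv ⟨x, hxS, hxu⟩ ⟨y, hyS, hyv⟩
  obtain ⟨x', hx'u, hx's⟩ : (u ∩ s).Nonempty := mem_closure_iff.1 (h₂ hxS) u hu hxu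
  obtain ⟨y', hy'v, hy's⟩ : (v ∩ s).Nonempty := mem_closure_iff.1 (h₂ hyS) v hv hyv
  obtain ⟨z, hzs, hz⟩ := hs u v hu hv ⟨x', hx's, hx'u⟩ ⟨y', hy's, hy'v⟩
  exact ⟨z, h₁ hzs, hz⟩

/-- The preimage of an irreducible set under an inducing map whose range contains it is
irreducible (it is homeomorphic to it). [folklore] -/
theorem IsIrreducible.preimage_of_isInducing {α β : Type*} [TopologicalSpace α]
    [TopologicalSpace β] {f : α → β} (hf : Topology.IsInducing f) {Z : Set β}
    (hZ : IsIrreducible Z) (hZf : Z ⊆ Set.range f) : IsIrreducible (f ⁻¹' Z) := by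
  refine ⟨?_, ?_⟩
  · obtain ⟨z, hz⟩ := hZ.nonempty
    obtain ⟨a, rfl⟩ := hZf hz
    exact ⟨a, hz⟩
  · rintro u v hu hv ⟨x, hxZ, hxu⟩ ⟨y, hyZ, hyv⟩
    obtain ⟨u', hu', rfl⟩ := hf.isOpen_iff.1 hu
    obtain ⟨v', hv', rfl⟩ := hf.isOpen_iff.1 hv
    obtain ⟨z, hzZ, hzu', hzv'⟩ := hZ.isPreirreducible u' v' hu' hv' ⟨f x, hxZ, hxu⟩ ⟨f y, hyZ, hyv⟩
    obtain ⟨a, rfl⟩ := hZf hzZ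
    exact ⟨a, hzZ, hzu', hzv'⟩

/-- The trace of an open set on a preirreducible set is preirreducible. [folklore] -/
theorem IsPreirreducible.inter_isOpen {α : Type*} [TopologicalSpace α] {t U : Set α}
    (ht : IsPreirreducible t) (hU : IsOpen U) : IsPreirreducible (U ∩ t) := by
  rintro u v hu hv ⟨x, ⟨hxU, hxt⟩, hxu⟩ ⟨y, ⟨hyU, hyt⟩, hyv⟩
  obtain ⟨z, hzt, ⟨hzu, hzU⟩, hzv, -⟩ := ht (u ∩ U) (v ∩ U) (hu.inter hU) (hv.inter hU)
    ⟨x, hxt, hxu, hxU⟩ ⟨y, hyt, hyv, hyU⟩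
  exact ⟨z, ⟨hzU, hzt⟩, hzu, hzv⟩

/-- Surjectivity of ring maps is invariant under isomorphisms of arrows. [folklore] -/
theorem surjective_of_arrow_iso {A B A' B' : CommRingCat.{u}} {a : A ⟶ B} {b : A' ⟶ B'}
    (φ : Arrow.mk a ≅ Arrow.mk b) (ha : Function.Surjective a) : Function.Surjective b := by
  let P : MorphismProperty CommRingCat :=
    RingHom.toMorphismProperty <| fun f ↦ Function.Surjective f
  haveI : P.RespectsIso :=
    RingHom.toMorphismProperty_respectsIso_iff.mp RingHom.surjective_respectsIso
  change P b
  rw [← MorphismProperty.arrow_mk_iso_iff (P := P) φ]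
  exact ha

/-- A morphism which is a closed immersion over an open `O'` of the target induces a topological
embedding of the preimage of `O'` into the target. [folklore] -/
theorem isInducing_restrict_of_isClosedImmersion_morphismRestrict {W P : Scheme.{u}} (g : W ⟶ P)
    (O' : P.Opens) [IsClosedImmersion (g ∣_ O')] :
    Topology.IsInducing (fun a : ↥(g ⁻¹ᵁ O') ↦ g.base a.1) := by
  have h1 : Topology.IsInducing ((g ∣_ O') ≫ O'.ι).base :=
    (O'.ι.isOpenEmbedding.isInducing).comp (g ∣_ O').isClosedEmbedding.isInducing
  rw [morphismRestrict_ι] at h1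
  exact h1

variable {L : Type u} [Field L]

/-- **The fibre of the resolution over the generic slice is irreducible.** Let `g : W ⟶ X ⊗ T` be a
morphism of `L`-schemes which is a closed immersion over an open `O' ⊆ X ⊗ T`, `t ∈ T(L)`, and
`F = g⁻¹(X × {t})`. If the slice identifies an irreducible `S ⊆ X` with `O' ∩ g(W) ∩ (X × {t})` and
`F ∩ g⁻¹O'` is dense in `F`, then `F` is irreducible: `F ∩ g⁻¹O' ≅ S` through the two embeddings,
and a set squeezed between an irreducible set and its closure is irreducible.
[cite: Hartshorne1977, I Prop. 1.5 and Ex. 1.6] -/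
theorem isIrreducible_preimage_range_sliceAt {X T W : SchemeOver L} (g : W ⟶ X ⊗ T)
    (t : AlgPoints T L) (O' : (X ⊗ T).left.Opens) [IsClosedImmersion (g.left ∣_ O')]
    {S : Set X.left} (hS : IsIrreducible S)
    (hSO : (sliceAt X t).left.base '' S =
      (O' : Set (X ⊗ T).left) ∩ Set.range g.left.base ∩ Set.range (sliceAt X t).left.base)
    (hdense : g.left.base ⁻¹' Set.range (sliceAt X t).left.base ⊆
      closure (g.left.base ⁻¹' Set.range (sliceAt X t).left.base ∩ g.left.base ⁻¹' O')) :
    IsIrreducible (g.left.base ⁻¹' Set.range (sliceAt X t).left.base) := by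
  set F := g.left.base ⁻¹' Set.range (sliceAt X t).left.base with hF
  -- `F ∩ g⁻¹O'` is irreducible
  have hemb := isInducing_restrict_of_isClosedImmersion_morphismRestrict g.left O'
  have hZ : IsIrreducible ((sliceAt X t).left.base '' S) :=
    hS.image _ (sliceAt X t).left.base.hom.continuous.continuousOn
  have hZr : (sliceAt X t).left.base '' S ⊆ Set.range (fun a : ↥(g.left ⁻¹ᵁ O') ↦ g.left.base a.1) := by
    rw [hSO]
    rintro _ ⟨⟨hzO, w, rfl⟩, -⟩
    exact ⟨⟨w, hzO⟩, rfl⟩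
  have hpre := IsIrreducible.preimage_of_isInducing hemb hZ hZr
  have himage : Subtype.val '' ((fun a : ↥(g.left ⁻¹ᵁ O') ↦ g.left.base a.1) ⁻¹'
      ((sliceAt X t).left.base '' S)) = F ∩ g.left.base ⁻¹' O' := by
    rw [hSO]
    ext w
    constructor
    · rintro ⟨a, ⟨⟨-, -⟩, hr⟩, rfl⟩
      exact ⟨hr, a.2⟩
    · rintro ⟨hwF, hwO⟩
      exact ⟨⟨w, hwO⟩, ⟨⟨hwO, Set.mem_range_self _⟩, hwF⟩, rfl⟩
  have hAF : IsIrreducible (F ∩ g.left.base ⁻¹' O') := by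
    rw [← himage]
    exact hpre.image _ continuous_subtype_val.continuousOn
  -- squeeze
  refine ⟨hAF.nonempty.mono Set.inter_subset_left, ?_⟩
  exact isPreirreducible_of_subset_of_subset_closure hAF.isPreirreducible Set.inter_subset_left hdense

end Irreducible

/-! ### Generic smoothness over the ground field -/

section GenericSmooth

variable {K : Type u} [Field K]

/-- Over a locally Noetherian base, locally of finite type implies locally of finite
presentation. [folklore] -/
private theorem locallyOfFinitePresentation_of_isLocallyNoetherian' {Y T : Scheme.{u}} (q : Y ⟶ T)
    [LocallyOfFiniteType q] [IsLocallyNoetherian T] : LocallyOfFinitePresentation q := by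
  rw [HasRingHomProperty.iff_appLE (P := @LocallyOfFinitePresentation)]
  intro U V e
  haveI := IsLocallyNoetherian.component_noetherian (X := T) U
  exact RingHom.FinitePresentation.of_finiteType.mp
    (HasRingHomProperty.appLE @LocallyOfFiniteType q inferInstance U V e)

/-- **Generic smoothness (characteristic zero).** A morphism `h₀ : W₀ ⟶ T₀` of smooth projective
varieties of dimensions `d + q` and `d` over a field of characteristic zero is smooth of relative
dimension `q` over an open neighbourhood of the generic point of `T₀`
(`Motives.exists_smooth_morphismRestrict_of_charZero`, Hartshorne III Cor. 10.7, with the relative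
dimension read off from `Motives.smoothOfRelativeDimension_morphismRestrict_of_smooth_of_smoothBase`).
[cite: Hartshorne1977, III Cor. 10.7 and Prop. 10.4] -/
theorem exists_smoothOfRelativeDimension_morphismRestrict_of_isSmoothProjective [CharZero K]
    {d q : ℕ} {W₀ T₀ : SchemeOver K} (hW₀ : IsSmoothProjective (d + q) W₀)
    (hT₀ : IsSmoothProjective d T₀) (h₀ : W₀ ⟶ T₀) :
    haveI := IsSmoothProjective.isIntegral_holds hT₀
    ∃ V₀ : T₀.left.Opens, genericPoint T₀.left ∈ V₀ ∧ SmoothOfRelativeDimension q (h₀.left ∣_ V₀) := by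
  haveI := IsSmoothProjective.isIntegral_holds hT₀
  haveI := hW₀.smoothOfRelativeDimension
  haveI := hT₀.smoothOfRelativeDimension
  haveI : IsProper W₀.hom := hW₀.isProjectiveOver.isProper
  haveI : IsProper T₀.hom := hT₀.isProjectiveOver.isProper
  haveI : IsProper (h₀.left ≫ T₀.hom) := by rw [Over.w h₀]; infer_instance
  haveI : IsProper h₀.left := IsProper.of_comp h₀.left T₀.hom
  haveI := IsSmoothProjective.isLocallyNoetherian_holds hT₀
  haveI : LocallyOfFinitePresentation h₀.left :=
    locallyOfFinitePresentation_of_isLocallyNoetherian' h₀.left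
  obtain ⟨V₀, hηV₀, -, hsm⟩ := Motives.exists_smooth_morphismRestrict_of_charZero
    (n := d + q) h₀
  exact ⟨V₀, hηV₀, Motives.smoothOfRelativeDimension_morphismRestrict_of_smooth_of_smoothBase
    (b := d) (r := q) h₀ V₀ hsm⟩

end GenericSmooth

/-! ### The fibre of the base-changed family over an `L`-point -/

section Family

variable {K L : Type u} [Field K] [Field L] (σ : K →+* L)

/-- `(g₀ ⊗ L) ≫ e⁻¹ ≫ pr_T = (g₀ ≫ pr_{T₀}) ⊗ L` for a product comparison `e` compatible with the
second projections. [folklore] -/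
theorem baseChangeHom_map_comp_inv_comp_snd {X₀ T₀ W₀ : SchemeOver K} (g₀ : W₀ ⟶ X₀ ⊗ T₀)
    (e : (baseChangeHom σ).obj X₀ ⊗ (baseChangeHom σ).obj T₀ ≅ (baseChangeHom σ).obj (X₀ ⊗ T₀))
    (he₂ : e.hom ≫ (baseChangeHom σ).map (snd X₀ T₀) = snd _ _) :
    ((baseChangeHom σ).map g₀ ≫ e.inv) ≫ snd _ _ = (baseChangeHom σ).map (g₀ ≫ snd X₀ T₀) := by
  rw [Functor.map_comp, Category.assoc, ← he₂, e.inv_hom_id_assoc]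

/-- The fibre square over an `L`-point `t`: `g⁻¹-slice ×` — for `g : W ⟶ X ⊗ T` and `t ∈ T(L)`,
`W ×_{X ⊗ T} X` (pulled back along the slice `i_t`) is the fibre of `g ≫ pr_T` over `t`
(pasting with `Motives.isPullback_sliceAt`). [folklore] -/
theorem isPullback_fst_sliceAt {X T W : SchemeOver L} (g : W ⟶ X ⊗ T) (t : AlgPoints T L) :
    IsPullback (pullback.fst g.left (sliceAt X t).left)
      (pullback.snd g.left (sliceAt X t).left ≫ X.hom) (g ≫ snd X T).left t.toSpecHom := by
  have s := IsPullback.of_hasPullback g.left (sliceAt X t).left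
  have sq := s.paste_vert (isPullback_sliceAt (X := X) t)
  exact sq

end Family

/-! ### The resolved family over the ground field -/

section GroundFamily

variable {K : Type u} [Field K]

/-- A closed subvariety of a projective `k`-scheme is projective (compose the closed immersions).
[cite: Hartshorne1977, II Ex. 4.9] -/
theorem isProjectiveOver_toSchemeOver' {P : SchemeOver K} (Z : ClosedSubvariety P.left)
    (h : IsProjectiveOver P) : IsProjectiveOver Z.toSchemeOver := by
  obtain ⟨N, ι, hι⟩ := h
  refine ⟨N, Z.ιOver ≫ ι, ?_⟩
  rw [Over.comp_left, ClosedSubvariety.ιOver_left]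
  haveI := hι
  exact IsClosedImmersion.comp Z.ι ι.left

set_option backward.isDefEq.respectTransparency false in
/-- **The resolved family of the spread.** Let `X₀`, `T₀` be smooth projective over an
algebraically closed field `K` of characteristic zero, of dimensions `m` and `d`, and
`ζ ∈ X₀ ⊗ T₀` a point of codimension `p ≤ m` lying over the generic point of `T₀`. Then
`Z₀ = closure {ζ}` has a resolution `g₀ : W₀ → X₀ ⊗ T₀` by a smooth projective variety `W₀` of
dimension `d + q`, `q + p = m` (Hironaka, `Resolution.Hironaka1964_projective_holds`, and
`dim + codim = m + d` on `X₀ ⊗ T₀`), which is onto `Z₀` and a closed immersion over an open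
`O ∋ ζ` of `X₀ ⊗ T₀` (birationality); and `W₀ → T₀` is smooth of relative dimension `q` over an
open `V₀` of `T₀` containing the generic point (generic smoothness in characteristic zero).
[cite: Kollar2007, Thm. 3.27] [cite: Hartshorne1977, III Cor. 10.7] -/
theorem exists_resolvedFamily [IsAlgClosed K] [CharZero K] {m d p : ℕ} {X₀ T₀ : SchemeOver K}
    (hX₀ : IsSmoothProjective m X₀) (hT₀ : IsSmoothProjective d T₀) (ζ : ↥(X₀ ⊗ T₀).left)
    (hζp : Order.coheight ζ = p) (hpm : p ≤ m)
    (hζT : IsGenericPoint ((snd X₀ T₀).left.base ζ) (⊤ : Set T₀.left)) :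
    ∃ (q : ℕ) (W₀ : SchemeOver K) (g₀ : W₀ ⟶ X₀ ⊗ T₀) (O : (X₀ ⊗ T₀).left.Opens)
      (V₀ : T₀.left.Opens),
      IsSmoothProjective (d + q) W₀ ∧ q + p = m ∧ IsClosedImmersion (g₀.left ∣_ O) ∧ ζ ∈ O ∧
      Set.range g₀.left.base = closure {ζ} ∧ (snd X₀ T₀).left.base ζ ∈ V₀ ∧
      SmoothOfRelativeDimension q ((g₀ ≫ snd X₀ T₀).left ∣_ V₀) := by
  have hP₀ : IsSmoothProjective (m + d) (X₀ ⊗ T₀) := IsSmoothProjective.tensor_holds hX₀ hT₀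
  haveI := hP₀.smoothOfRelativeDimension
  haveI := IsSmoothProjective.isIntegral_holds hP₀
  haveI := IsSmoothProjective.isIntegral_holds hT₀
  -- the subvariety `Z₀ = closure {ζ}` and its resolution
  set Z := ClosedSubvariety.ofPoint (X₀ ⊗ T₀).left ζ with hZdef
  haveI : IsIntegral Z.toSchemeOver.left := inferInstanceAs (IsIntegral Z.carrier)
  obtain ⟨N, W₀, π, hW₀, hπ, hdim⟩ := Resolution.Hironaka1964_projective_holds K Z.toSchemeOver
    (isProjectiveOver_toSchemeOver' Z hP₀.isProjectiveOver)
  haveI := IsSmoothProjective.isIntegral_holds hW₀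
  -- dimensions: `N = height ζ`, `height ζ + p = m + d`
  have hNζ : Order.height ζ = N := by
    rw [← hdim]
    have e1 : Z.ι.base (genericPoint Z.carrier) = ζ := ClosedSubvariety.genericPoint_ofPoint ζ
    rw [← e1]
    exact Motives.Scheme.height_base_eq_of_isClosedImmersion Z.ι _
  have hsum := height_add_coheight_eq_of_smoothOfRelativeDimension (X₀ ⊗ T₀).hom (m + d) ζ
  rw [hNζ, hζp] at hsum
  have hNp : N + p = m + d := by exact_mod_cast hsum
  obtain ⟨q, rfl⟩ : ∃ q, N = d + q := ⟨N - d, by omega⟩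
  have hqp : q + p = m := by omega
  -- birationality: an open `O` of `X₀ ⊗ T₀` over which `g₀ = π ≫ ι` is a closed immersion
  let πl : W₀.left ⟶ Z.carrier := π.left
  have hπ' : Resolution.IsBirational πl := hπ
  obtain ⟨U, hUd, -, hiso⟩ := hπ'
  haveI := hiso
  obtain ⟨O', hO', hO'U⟩ := Z.ι.isClosedEmbedding.isInducing.isOpen_iff.1 U.2
  let O : (X₀ ⊗ T₀).left.Opens := ⟨O', hO'⟩
  have hOU : Z.ι ⁻¹ᵁ O = U := TopologicalSpace.Opens.ext hO'U
  subst hOU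
  let g₀ : W₀ ⟶ X₀ ⊗ T₀ := π ≫ Z.ιOver
  have hg₀ : g₀.left = πl ≫ Z.ι := rfl
  have hci : IsClosedImmersion (g₀.left ∣_ O) := by
    rw [hg₀, morphismRestrict_comp]
    haveI : IsClosedImmersion (Z.ι ∣_ O) :=
      IsZariskiLocalAtTarget.restrict (P := @IsClosedImmersion) inferInstance O
    infer_instance
  -- `ζ ∈ O`: the generic point of `Z` lies in the dense open `U = ι⁻¹ O`
  have hgenU : genericPoint Z.carrier ∈ Z.ι ⁻¹ᵁ O :=
    ((genericPoint_spec Z.carrier).mem_open_set_iff (Z.ι ⁻¹ᵁ O).2).2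
      (by simpa using hUd.nonempty)
  have hζO : ζ ∈ O := by
    have e1 : Z.ι.base (genericPoint Z.carrier) = ζ := ClosedSubvariety.genericPoint_ofPoint ζ
    rw [← e1]
    exact hgenU
  -- `g₀` is onto `Z₀ = closure {ζ}`: proper with dense image containing `U`
  have hrange : Set.range g₀.left.base = closure {ζ} := by
    rw [hg₀, Scheme.Hom.comp_base, TopCat.coe_comp, Set.range_comp,
      ← ClosedSubvariety.range_ofPoint_ι ζ]
    -- `πl` is surjective
    haveI : IsProper W₀.hom := hW₀.isProjectiveOver.isProper
    haveI : IsProper (X₀ ⊗ T₀).hom := hP₀.isProjectiveOver.isProper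
    haveI : IsSeparated (Z.ι ≫ (X₀ ⊗ T₀).hom) := inferInstance
    have hw : πl ≫ Z.ι ≫ (X₀ ⊗ T₀).hom = W₀.hom := by
      rw [← Category.assoc, ← hg₀]; exact Over.w g₀
    haveI : IsProper (πl ≫ Z.ι ≫ (X₀ ⊗ T₀).hom) := by rw [hw]; infer_instance
    haveI : IsProper πl := IsProper.of_comp πl (Z.ι ≫ (X₀ ⊗ T₀).hom)
    have hcl : IsClosed (Set.range πl.base) := πl.isClosedMap.isClosed_range
    have hUsub : ((Z.ι ⁻¹ᵁ O : Z.carrier.Opens) : Set Z.carrier) ⊆ Set.range πl.base := by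
      intro u hu
      refine ⟨(πl ⁻¹ᵁ (Z.ι ⁻¹ᵁ O)).ι.base ((inv (πl ∣_ (Z.ι ⁻¹ᵁ O))).base ⟨u, hu⟩), ?_⟩
      have h1 : ((inv (πl ∣_ (Z.ι ⁻¹ᵁ O))) ≫ (πl ⁻¹ᵁ (Z.ι ⁻¹ᵁ O)).ι ≫ πl) =
          (Z.ι ⁻¹ᵁ O).ι := by
        rw [← morphismRestrict_ι, IsIso.inv_hom_id_assoc]
      have h2 := congrArg (fun f ↦ f.base ⟨u, hu⟩) h1
      simpa using h2
    have hdense : Dense (Set.range πl.base) := hUd.mono hUsub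
    have hsurj : Set.range πl.base = Set.univ := by
      rw [← Set.univ_subset_iff, ← hdense.closure_eq, hcl.closure_eq]
    rw [hsurj, Set.image_univ]
  -- generic smoothness of `W₀ → T₀`
  obtain ⟨V₀, hηV₀, hsm⟩ :=
    exists_smoothOfRelativeDimension_morphismRestrict_of_isSmoothProjective hW₀ hT₀ (g₀ ≫ snd X₀ T₀)
  refine ⟨q, W₀, g₀, O, V₀, hW₀, hqp, hci, hζO, hrange, ?_, hsm⟩
  rw [hζT.eq (genericPoint_spec T₀.left)]
  exact hηV₀

end GroundFamily

/-! ### The complex side: the fibre of the base-changed resolution over the generic slice -/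

section ComplexSide

variable {K : Type} [Field K] (σ : K →+* ℂ)

/-- **The fibre of the base-changed family over an `ℂ`-point is a base change of `h₀ ∣_ V₀`.** For
`g = (g₀ ⊗_σ ℂ) ≫ e⁻¹ : W ⟶ X ⊗ T` and `t ∈ T(ℂ)` mapping into the open `V₀ ⊆ T₀`, the pull-back
`W ×_{X ⊗ T} X` along the slice `i_t` (the fibre of `h = g ≫ pr_T` over `t`) is cartesian over
`h₀ ∣_ V₀`, `h₀ = g₀ ≫ pr_{T₀}`; in particular it is smooth of relative dimension `q` over `ℂ` when
`h₀ ∣_ V₀` is, and it is cartesian over `h₀` along `Spec ℂ → T₀`. [folklore] -/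
theorem isPullback_fibre_of_baseChangeHom {X₀ T₀ W₀ : SchemeOver K} (g₀ : W₀ ⟶ X₀ ⊗ T₀)
    (e : (baseChangeHom σ).obj X₀ ⊗ (baseChangeHom σ).obj T₀ ≅ (baseChangeHom σ).obj (X₀ ⊗ T₀))
    (he₂ : e.hom ≫ (baseChangeHom σ).map (snd X₀ T₀) = snd _ _)
    (t : Motives.ComplexPoints ((baseChangeHom σ).obj T₀)) :
    IsPullback
      (pullback.fst ((baseChangeHom σ).map g₀ ≫ e.inv).left (sliceAt ((baseChangeHom σ).obj X₀) t).left ≫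
        baseChangeHomFst σ W₀)
      (pullback.snd ((baseChangeHom σ).map g₀ ≫ e.inv).left (sliceAt ((baseChangeHom σ).obj X₀) t).left ≫
        ((baseChangeHom σ).obj X₀).hom)
      (g₀ ≫ snd X₀ T₀).left (t.toSpecHom ≫ baseChangeHomFst σ T₀) := by
  have sq := isPullback_fst_sliceAt ((baseChangeHom σ).map g₀ ≫ e.inv) t
  rw [baseChangeHom_map_comp_inv_comp_snd σ g₀ e he₂] at sq
  exact sq.paste_horiz (SpreadingOutQbar.isPullback_baseChangeHom_map_left σ (g₀ ≫ snd X₀ T₀))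

set_option backward.isDefEq.respectTransparency false in
/-- The fibre over `t` is smooth of relative dimension `q` over `ℂ` when `t` maps into an open
`V₀ ⊆ T₀` over which `h₀` is smooth of relative dimension `q`. [folklore] -/
theorem smoothOfRelativeDimension_fibre_of_baseChangeHom {X₀ T₀ W₀ : SchemeOver K}
    (g₀ : W₀ ⟶ X₀ ⊗ T₀)
    (e : (baseChangeHom σ).obj X₀ ⊗ (baseChangeHom σ).obj T₀ ≅ (baseChangeHom σ).obj (X₀ ⊗ T₀))
    (he₂ : e.hom ≫ (baseChangeHom σ).map (snd X₀ T₀) = snd _ _)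
    (t : Motives.ComplexPoints ((baseChangeHom σ).obj T₀)) (V₀ : T₀.left.Opens) {q : ℕ}
    [SmoothOfRelativeDimension q ((g₀ ≫ snd X₀ T₀).left ∣_ V₀)]
    (htV₀ : (baseChangeHomFst σ T₀).base t.pt ∈ V₀) :
    SmoothOfRelativeDimension q
      (pullback.snd ((baseChangeHom σ).map g₀ ≫ e.inv).left (sliceAt ((baseChangeHom σ).obj X₀) t).left ≫
        ((baseChangeHom σ).obj X₀).hom) := by
  have H := isPullback_fibre_of_baseChangeHom σ g₀ e he₂ t
  haveI : Subsingleton ↥(Spec (CommRingCat.of ℂ)) := inferInstanceAs (Subsingleton (PrimeSpectrum ℂ))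
  have hrange : Set.range (t.toSpecHom ≫ baseChangeHomFst σ T₀).base ⊆ Set.range V₀.ι.base := by
    rw [Scheme.Opens.range_ι]
    rintro _ ⟨x, rfl⟩
    rw [show x = IsLocalRing.closedPoint ℂ from Subsingleton.elim _ _]
    exact htV₀
  set c : Spec (CommRingCat.of ℂ) ⟶ (V₀ : Scheme) :=
    IsOpenImmersion.lift V₀.ι (t.toSpecHom ≫ baseChangeHomFst σ T₀) hrange with hc
  have hcf : c ≫ V₀.ι = t.toSpecHom ≫ baseChangeHomFst σ T₀ := IsOpenImmersion.lift_fac _ _ _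
  have H2 : IsPullback
      (pullback.fst ((baseChangeHom σ).map g₀ ≫ e.inv).left (sliceAt ((baseChangeHom σ).obj X₀) t).left ≫
        baseChangeHomFst σ W₀)
      (pullback.snd ((baseChangeHom σ).map g₀ ≫ e.inv).left (sliceAt ((baseChangeHom σ).obj X₀) t).left ≫
        ((baseChangeHom σ).obj X₀).hom)
      (g₀ ≫ snd X₀ T₀).left (c ≫ V₀.ι) := by
    rw [hcf]
    exact H
  have H' := IsPullback.of_right' H2 (isPullback_morphismRestrict (g₀ ≫ snd X₀ T₀).left V₀).flip
  haveI := smoothOfRelativeDimension_isStableUnderBaseChange (n := q)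
  exact MorphismProperty.of_isPullback H' ‹_›

/-- `g = (g₀ ⊗ ℂ) ≫ e⁻¹` is a closed immersion over `(e ≫ π)⁻¹ O` when `g₀` is one over `O`.
[folklore] -/
theorem isClosedImmersion_morphismRestrict_of_baseChangeHom {X₀ T₀ W₀ : SchemeOver K}
    (g₀ : W₀ ⟶ X₀ ⊗ T₀) (O : (X₀ ⊗ T₀).left.Opens) [IsClosedImmersion (g₀.left ∣_ O)]
    (e : (baseChangeHom σ).obj X₀ ⊗ (baseChangeHom σ).obj T₀ ≅ (baseChangeHom σ).obj (X₀ ⊗ T₀)) :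
    IsClosedImmersion (((baseChangeHom σ).map g₀ ≫ e.inv).left ∣_
      ((e.hom.left ≫ baseChangeHomFst σ (X₀ ⊗ T₀)) ⁻¹ᵁ O)) := by
  have h1 : IsClosedImmersion (((baseChangeHom σ).map g₀).left ∣_ (baseChangeHomFst σ (X₀ ⊗ T₀) ⁻¹ᵁ O)) :=
    morphismRestrict_of_isPullback (W := @IsClosedImmersion)
      (SpreadingOutQbar.isPullback_baseChangeHom_map_left σ g₀) O ‹_›
  have h2 : e.inv.left ⁻¹ᵁ ((e.hom.left ≫ baseChangeHomFst σ (X₀ ⊗ T₀)) ⁻¹ᵁ O) =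
      baseChangeHomFst σ (X₀ ⊗ T₀) ⁻¹ᵁ O := by
    rw [← Scheme.Hom.comp_preimage, ← Category.assoc, ← Over.comp_left, e.inv_hom_id, Over.id_left,
      Category.id_comp]
  have h3 : IsClosedImmersion (((baseChangeHom σ).map g₀).left ∣_
      (e.inv.left ⁻¹ᵁ ((e.hom.left ≫ baseChangeHomFst σ (X₀ ⊗ T₀)) ⁻¹ᵁ O))) :=
    ((MorphismProperty.arrow_mk_iso_iff @IsClosedImmersion
      (morphismRestrictEq ((baseChangeHom σ).map g₀).left h2)).mpr h1)
  haveI := h3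
  haveI : IsIso e.inv.left := by
    change IsIso ((Over.forget _).map e.inv)
    infer_instance
  haveI h4 : IsIso (e.inv.left ∣_ ((e.hom.left ≫ baseChangeHomFst σ (X₀ ⊗ T₀)) ⁻¹ᵁ O)) :=
    inferInstance
  change IsClosedImmersion ((((baseChangeHom σ).map g₀).left ≫ e.inv.left) ∣_
    ((e.hom.left ≫ baseChangeHomFst σ (X₀ ⊗ T₀)) ⁻¹ᵁ O))
  rw [morphismRestrict_comp]
  have h5 : IsClosedImmersion (e.inv.left ∣_ ((e.hom.left ≫ baseChangeHomFst σ (X₀ ⊗ T₀)) ⁻¹ᵁ O)) :=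
    inferInstance
  exact @IsClosedImmersion.comp _ _ _ _ _ h3 h5

/-- The image of `g = (g₀ ⊗ ℂ) ≫ e⁻¹` is the preimage of the image of `g₀`. [folklore] -/
theorem range_baseChangeHom_map_comp_inv {X₀ T₀ W₀ : SchemeOver K} (g₀ : W₀ ⟶ X₀ ⊗ T₀)
    (e : (baseChangeHom σ).obj X₀ ⊗ (baseChangeHom σ).obj T₀ ≅ (baseChangeHom σ).obj (X₀ ⊗ T₀)) :
    Set.range ((baseChangeHom σ).map g₀ ≫ e.inv).left.base =
      (e.hom.left ≫ baseChangeHomFst σ (X₀ ⊗ T₀)).base ⁻¹' Set.range g₀.left.base := by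
  have H := SpreadingOutQbar.isPullback_baseChangeHom_map_left σ g₀
  have hr : Set.range ((baseChangeHom σ).map g₀).left.base =
      (baseChangeHomFst σ (X₀ ⊗ T₀)).base ⁻¹' Set.range g₀.left.base := by
    rw [← H.isoPullback_hom_snd, Scheme.Hom.comp_base, TopCat.coe_comp, Set.range_comp,
      Set.range_eq_univ.mpr H.isoPullback.hom.surjective, Set.image_univ, Scheme.Pullback.range_snd]
  rw [Over.comp_left, Scheme.Hom.comp_base, TopCat.coe_comp, Set.range_comp, hr]
  ext y
  constructor
  · rintro ⟨x, hx, rfl⟩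
    change (baseChangeHomFst σ (X₀ ⊗ T₀)).base (e.hom.left.base (e.inv.left.base x)) ∈
      Set.range g₀.left.base
    rwa [show e.hom.left.base (e.inv.left.base x) = x from by
      change (e.inv ≫ e.hom).left.base x = x
      rw [e.inv_hom_id]; rfl]
  · intro hy
    refine ⟨e.hom.left.base y, hy, ?_⟩
    change (e.hom ≫ e.inv).left.base y = y
    rw [e.hom_inv_id]; rfl

/-- **The spread class over the generic slice, from a resolved family over `K`.** In the
situation of `exists_resolvedFamily` base-changed along `σ : K →+* ℂ` (`g = (g₀ ⊗ ℂ) ≫ e⁻¹ : W ⟶ X ⊗ T`,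
`t ∈ T(ℂ)` over the generic point of `T₀`, inside the smooth locus `V₀`), suppose the slice `Φ_t`
identifies an irreducible closed `V ⊆ X` with the preimage of `g₀(W₀)` and sends its generic point
into the open `O` over which `g₀` is a closed immersion. Then the push-forward class
`κ = g_* 1 ∈ H^{2p}(X ⊗ T)` dies off `𝒱 = (e ≫ π)⁻¹ g₀(W₀)` and has non-zero slice `i_t^* κ`
(`exists_spreadClass_of_resolution`): the fibre `F = g⁻¹(X × {t})` is the base change of the
generic fibre of `W₀ → T₀`, hence smooth of dimension `q` (generic smoothness), irreducible
(`range_subset_closure_inter_preimage`, `isIrreducible_preimage_range_sliceAt`) and of codimension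
`d`, and `F → X` is immersive at a complex point of `F ∩ g⁻¹O'`.
[cite: CharlesSchnell2014Notes, Remark after Cor. 11.3.16] [cite: Fulton1998, §19.1 and Example 19.1.10] -/
theorem exists_spreadClass_of_groundFamily (μ : OrientationFamily) [IsAlgClosed K] [CharZero K]
    {m d q p : ℕ} {X₀ T₀ W₀ : SchemeOver K}
    (hX : IsSmoothProjective m ((baseChangeHom σ).obj X₀)) (hT₀ : IsSmoothProjective d T₀)
    (hW₀ : IsSmoothProjective (d + q) W₀) (hqp : q + p = m) (hd : 1 ≤ d)
    (g₀ : W₀ ⟶ X₀ ⊗ T₀) (hg₀c : IsClosed (Set.range g₀.left.base))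
    (O : (X₀ ⊗ T₀).left.Opens) [IsClosedImmersion (g₀.left ∣_ O)]
    (V₀ : T₀.left.Opens) [SmoothOfRelativeDimension q ((g₀ ≫ snd X₀ T₀).left ∣_ V₀)]
    (e : (baseChangeHom σ).obj X₀ ⊗ (baseChangeHom σ).obj T₀ ≅ (baseChangeHom σ).obj (X₀ ⊗ T₀))
    (he₂ : e.hom ≫ (baseChangeHom σ).map (snd X₀ T₀) = snd _ _)
    (t : Motives.ComplexPoints ((baseChangeHom σ).obj T₀))
    (htV₀ : (baseChangeHomFst σ T₀).base t.pt ∈ V₀)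
    (htgen : IsGenericPoint ((baseChangeHomFst σ T₀).base t.pt) (⊤ : Set T₀.left))
    {V : Set ((baseChangeHom σ).obj X₀).left} (hV : IsIrreducible V) (hVc : IsClosed V)
    (hVΦ : V = ((sliceAt ((baseChangeHom σ).obj X₀) t).left ≫ e.hom.left ≫
      baseChangeHomFst σ (X₀ ⊗ T₀)).base ⁻¹' Set.range g₀.left.base)
    (hηO : ((sliceAt ((baseChangeHom σ).obj X₀) t).left ≫ e.hom.left ≫
      baseChangeHomFst σ (X₀ ⊗ T₀)).base hV.genericPoint ∈ O) :
    ∃ κ : complexBetti ((baseChangeHom σ).obj X₀ ⊗ (baseChangeHom σ).obj T₀) (2 * p),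
      complexBetti.restrictCompl ((baseChangeHom σ).obj X₀ ⊗ (baseChangeHom σ).obj T₀)
        ((e.hom.left ≫ baseChangeHomFst σ (X₀ ⊗ T₀)).base ⁻¹' Set.range g₀.left.base) (2 * p) κ = 0 ∧
      complexBetti.map (sliceAt ((baseChangeHom σ).obj X₀) t) (2 * p) κ ≠ 0 := by
  -- the varieties over `ℂ`
  have hT : IsSmoothProjective d ((baseChangeHom σ).obj T₀) :=
    IsSmoothProjective.baseChangeHom_holds σ hT₀
  have hW : IsSmoothProjective (d + q) ((baseChangeHom σ).obj W₀) :=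
    IsSmoothProjective.baseChangeHom_holds σ hW₀
  haveI := IsSmoothProjective.isIntegral_holds hT₀
  haveI := IsSmoothProjective.isIntegral_holds hW₀
  haveI := IsSmoothProjective.isIntegral_holds hW
  haveI := IsSmoothProjective.isIntegral_holds hX
  haveI := hX.smoothOfRelativeDimension
  haveI := hT.smoothOfRelativeDimension
  haveI := hW.smoothOfRelativeDimension
  haveI : LocallyOfFiniteType ((baseChangeHom σ).obj X₀).hom := by
    haveI : Smooth ((baseChangeHom σ).obj X₀).hom := SmoothOfRelativeDimension.smooth m _
    infer_instance
  haveI : LocallyOfFiniteType ((baseChangeHom σ).obj T₀).hom := by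
    haveI : Smooth ((baseChangeHom σ).obj T₀).hom := SmoothOfRelativeDimension.smooth d _
    infer_instance
  haveI : LocallyOfFiniteType ((baseChangeHom σ).obj W₀).hom := by
    haveI : Smooth ((baseChangeHom σ).obj W₀).hom := SmoothOfRelativeDimension.smooth (d + q) _
    infer_instance
  have hηV : hV.genericPoint ∈ V := (hV.isGenericPoint_genericPoint hVc).mem
  -- the slice-then-project map `Φ_t`
  set Φ := ((sliceAt ((baseChangeHom σ).obj X₀) t).left ≫ e.hom.left ≫
      baseChangeHomFst σ (X₀ ⊗ T₀)) with hΦ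
  -- the morphism `g = (g₀ ⊗ ℂ) ≫ e⁻¹`
  obtain ⟨g, hg⟩ : ∃ g : (baseChangeHom σ).obj W₀ ⟶ (baseChangeHom σ).obj X₀ ⊗ (baseChangeHom σ).obj T₀,
      g = (baseChangeHom σ).map g₀ ≫ e.inv := ⟨_, rfl⟩
  -- its image is `𝒱`
  have hrange := range_baseChangeHom_map_comp_inv σ g₀ e
  rw [← hg] at hrange
  have h𝒱 : IsClosed ((e.hom.left ≫ baseChangeHomFst σ (X₀ ⊗ T₀)).base ⁻¹' Set.range g₀.left.base) :=
    hg₀c.preimage (Scheme.Hom.continuous _)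
  -- `g ≫ pr_T = h₀ ⊗ ℂ` is surjective
  have hh : g ≫ snd _ _ = (baseChangeHom σ).map (g₀ ≫ snd X₀ T₀) := by
    rw [hg]; exact baseChangeHom_map_comp_inv_comp_snd σ g₀ e he₂
  have hΦsnd : Φ ≫ (snd X₀ T₀).left = ((baseChangeHom σ).obj X₀).hom ≫ t.left ≫ baseChangeHomFst σ T₀ :=
    sliceAt_comp_baseChangeHomFst_comp_snd σ X₀ T₀ t e he₂
  haveI hs₀ : Surjective (g₀ ≫ snd X₀ T₀).left := by
    -- proper with dense image (it contains the generic point of `T₀`)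
    haveI : IsProper W₀.hom := hW₀.isProjectiveOver.isProper
    haveI : IsProper T₀.hom := hT₀.isProjectiveOver.isProper
    haveI : IsProper ((g₀ ≫ snd X₀ T₀).left ≫ T₀.hom) := by rw [Over.w]; infer_instance
    haveI : IsProper (g₀ ≫ snd X₀ T₀).left := IsProper.of_comp _ T₀.hom
    have hcl : IsClosed (Set.range (g₀ ≫ snd X₀ T₀).left.base) :=
      (g₀ ≫ snd X₀ T₀).left.isClosedMap.isClosed_range
    obtain ⟨w, hw⟩ : Φ.base hV.genericPoint ∈ Set.range g₀.left.base := by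
      rw [← Set.mem_preimage, ← hVΦ]; exact hηV
    haveI : Subsingleton ↥(Spec (CommRingCat.of ℂ)) := inferInstanceAs (Subsingleton (PrimeSpectrum ℂ))
    have hpt : ((baseChangeHom σ).obj X₀).hom.base hV.genericPoint = IsLocalRing.closedPoint ℂ :=
      Subsingleton.elim _ _
    have hgen : (g₀ ≫ snd X₀ T₀).left.base w = (baseChangeHomFst σ T₀).base t.pt := by
      rw [Over.comp_left, Scheme.Hom.comp_base, TopCat.coe_comp, Function.comp_apply, hw]
      change (Φ ≫ (snd X₀ T₀).left).base hV.genericPoint = _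
      rw [hΦsnd]
      change (baseChangeHomFst σ T₀).base (t.left.base (((baseChangeHom σ).obj X₀).hom.base
        hV.genericPoint)) = (baseChangeHomFst σ T₀).base (t.left.base (IsLocalRing.closedPoint ℂ))
      rw [hpt]
    have hdense : Dense (Set.range (g₀ ≫ snd X₀ T₀).left.base) := by
      have h1 : IsGenericPoint ((g₀ ≫ snd X₀ T₀).left.base w) ⊤ := by rw [hgen]; exact htgen
      rw [dense_iff_closure_eq, ← Set.univ_subset_iff, ← Set.top_eq_univ, ← h1]
      exact closure_mono (Set.singleton_subset_iff.2 (Set.mem_range_self w))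
    refine ⟨fun y ↦ ?_⟩
    have : y ∈ Set.range (g₀ ≫ snd X₀ T₀).left.base := by
      rw [← hcl.closure_eq, hdense.closure_eq]; trivial
    exact this
  haveI : Surjective (g ≫ snd _ _).left := by
    rw [hh]
    exact MorphismProperty.of_isPullback
      (SpreadingOutQbar.isPullback_baseChangeHom_map_left σ (g₀ ≫ snd X₀ T₀)) hs₀
  have hdom : (g₀ ≫ snd X₀ T₀).left.base (genericPoint W₀.left) = genericPoint T₀.left := by
    apply IsGenericPoint.eq _ (genericPoint_spec _)
    have h := (genericPoint_spec W₀.left).image (g₀ ≫ snd X₀ T₀).left.continuous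
    rw [Set.image_univ, (g₀ ≫ snd X₀ T₀).left.surjective.range_eq, closure_univ] at h
    exact h
  -- the fibre `F = g⁻¹(X × {t})` and the fibre scheme `F'`
  set F : Set ((baseChangeHom σ).obj W₀).left :=
    g.left.base ⁻¹' Set.range (sliceAt ((baseChangeHom σ).obj X₀) t).left.base with hF
  haveI : IsClosedImmersion (sliceAt ((baseChangeHom σ).obj X₀) t).left :=
    isClosedImmersion_sliceAt_left t
  have hFc : IsClosed F :=
    (sliceAt ((baseChangeHom σ).obj X₀) t).left.isClosedEmbedding.isClosed_range.preimage
      g.left.continuous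
  let i := pullback.fst g.left (sliceAt ((baseChangeHom σ).obj X₀) t).left
  let j := pullback.snd g.left (sliceAt ((baseChangeHom σ).obj X₀) t).left
  have hij : i ≫ g.left = j ≫ (sliceAt ((baseChangeHom σ).obj X₀) t).left := pullback.condition
  haveI : IsClosedImmersion i := MorphismProperty.pullback_fst _ _ inferInstance
  have hri : Set.range i.base = F := Scheme.Pullback.range_fst _ _
  let F' : SchemeOver ℂ := Over.mk (j ≫ ((baseChangeHom σ).obj X₀).hom)
  have hiw : i ≫ ((baseChangeHom σ).obj W₀).hom = j ≫ ((baseChangeHom σ).obj X₀).hom := by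
    rw [← Over.w g, ← Category.assoc, hij, Category.assoc,
      Over.w (sliceAt ((baseChangeHom σ).obj X₀) t)]
  let i' : F' ⟶ (baseChangeHom σ).obj W₀ := Over.homMk i hiw
  -- `F'` is smooth of relative dimension `q` over `ℂ`
  have hsmF : SmoothOfRelativeDimension q F'.hom := by
    have h := smoothOfRelativeDimension_fibre_of_baseChangeHom σ g₀ e he₂ t V₀ (q := q) htV₀
    rw [← hg] at h
    exact h
  -- `F ∩ g⁻¹O'` is dense in `F`
  have Hsq := isPullback_fibre_of_baseChangeHom σ g₀ e he₂ t
  rw [← hg] at Hsq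
  have hτ : (t.toSpecHom ≫ baseChangeHomFst σ T₀).base (IsLocalRing.closedPoint ℂ) =
      genericPoint T₀.left := htgen.eq (genericPoint_spec _)
  obtain ⟨w, hw⟩ : Φ.base hV.genericPoint ∈ Set.range g₀.left.base := by
    rw [← Set.mem_preimage, ← hVΦ]; exact hηV
  have hA₀ : ((g₀.left ⁻¹ᵁ O : W₀.left.Opens) : Set W₀.left).Nonempty :=
    ⟨w, by change g₀.left.base w ∈ O; rw [hw]; exact hηO⟩
  have hD := range_subset_closure_inter_preimage σ (g₀ ≫ snd X₀ T₀) hdom i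
    (j ≫ ((baseChangeHom σ).obj X₀).hom) (t.toSpecHom ≫ baseChangeHomFst σ T₀) hτ Hsq
    (g₀.left ⁻¹ᵁ O) hA₀
  set O' : ((baseChangeHom σ).obj X₀ ⊗ (baseChangeHom σ).obj T₀).left.Opens :=
    (e.hom.left ≫ baseChangeHomFst σ (X₀ ⊗ T₀)) ⁻¹ᵁ O with hO'
  have heie : ∀ y, e.hom.left.base (e.inv.left.base y) = y := fun y ↦ by
    change (e.inv ≫ e.hom).left.base y = y
    rw [e.inv_hom_id]
    rfl
  have hpre : (baseChangeHomFst σ W₀).base ⁻¹' ((g₀.left ⁻¹ᵁ O : W₀.left.Opens) : Set W₀.left) =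
      g.left.base ⁻¹' (O' : Set _) := by
    ext x
    have e1 : g₀.left.base ((baseChangeHomFst σ W₀).base x) =
        (baseChangeHomFst σ (X₀ ⊗ T₀)).base (((baseChangeHom σ).map g₀).left.base x) := by
      change (baseChangeHomFst σ W₀ ≫ g₀.left).base x =
        (((baseChangeHom σ).map g₀).left ≫ baseChangeHomFst σ (X₀ ⊗ T₀)).base x
      rw [baseChangeHom_map_left_comp_fst]
    have e2 : g.left.base x = e.inv.left.base (((baseChangeHom σ).map g₀).left.base x) := by
      rw [hg]; rfl
    change g₀.left.base ((baseChangeHomFst σ W₀).base x) ∈ O ↔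
      (baseChangeHomFst σ (X₀ ⊗ T₀)).base (e.hom.left.base (g.left.base x)) ∈ O
    rw [e1, e2, heie]
  have hdense : F ⊆ closure (F ∩ g.left.base ⁻¹' (O' : Set _)) := by
    rw [← hri, ← hpre]; exact hD
  -- `F` is irreducible
  haveI : IsClosedImmersion (g.left ∣_ O') := by
    rw [hg]; exact isClosedImmersion_morphismRestrict_of_baseChangeHom σ g₀ O e
  have hηO' : (sliceAt ((baseChangeHom σ).obj X₀) t).left.base hV.genericPoint ∈ (O' : Set _) := hηO
  have hS : IsIrreducible ((sliceAt ((baseChangeHom σ).obj X₀) t).left.base ⁻¹' (O' : Set _) ∩ V) :=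
    ⟨⟨hV.genericPoint, hηO', hηV⟩,
      IsPreirreducible.inter_isOpen hV.isPreirreducible (O'.2.preimage (Scheme.Hom.continuous _))⟩
  have hSO : (sliceAt ((baseChangeHom σ).obj X₀) t).left.base ''
      ((sliceAt ((baseChangeHom σ).obj X₀) t).left.base ⁻¹' (O' : Set _) ∩ V) =
      (O' : Set _) ∩ Set.range g.left.base ∩
        Set.range (sliceAt ((baseChangeHom σ).obj X₀) t).left.base := by
    rw [hrange]
    have hVs : V = (sliceAt ((baseChangeHom σ).obj X₀) t).left.base ⁻¹'
        ((e.hom.left ≫ baseChangeHomFst σ (X₀ ⊗ T₀)).base ⁻¹' Set.range g₀.left.base) := by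
      rw [hVΦ]; rfl
    rw [hVs, ← Set.preimage_inter, Set.image_preimage_eq_inter_range]
  have hFi : IsIrreducible F := isIrreducible_preimage_range_sliceAt g t O' hS hSO hdense
  -- the points of `F` have codimension `≥ d`
  haveI : SmoothOfRelativeDimension q ((g ≫ snd _ _).left ∣_ (baseChangeHomFst σ T₀ ⁻¹ᵁ V₀)) := by
    rw [hh]
    haveI := smoothOfRelativeDimension_isStableUnderBaseChange (n := q)
    exact morphismRestrict_of_isPullback (W := @SmoothOfRelativeDimension q)
      (SpreadingOutQbar.isPullback_baseChangeHom_map_left σ (g₀ ≫ snd X₀ T₀)) V₀ ‹_›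
  haveI : Subsingleton ↥(Spec (CommRingCat.of ℂ)) := inferInstanceAs (Subsingleton (PrimeSpectrum ℂ))
  have hFd : ∀ f ∈ F, (d : ℕ∞) ≤ Order.coheight f := by
    intro f hf
    obtain ⟨x, hx⟩ := hf
    have hft : (g ≫ snd _ _).left.base f = t.pt := by
      change (snd ((baseChangeHom σ).obj X₀) ((baseChangeHom σ).obj T₀)).left.base (g.left.base f) = _
      rw [← hx]
      change ((sliceAt ((baseChangeHom σ).obj X₀) t) ≫
        snd ((baseChangeHom σ).obj X₀) ((baseChangeHom σ).obj T₀)).left.base x = _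
      rw [sliceAt_snd]
      change t.left.base (((baseChangeHom σ).obj X₀).hom.base x) = t.left.base (IsLocalRing.closedPoint ℂ)
      rw [Subsingleton.elim (((baseChangeHom σ).obj X₀).hom.base x) (IsLocalRing.closedPoint ℂ)]
    have hle := height_le_of_smoothOfRelativeDimension_morphismRestrict (g ≫ snd _ _)
      (baseChangeHomFst σ T₀ ⁻¹ᵁ V₀) (q := q) t htV₀ hft
    have hsum := height_add_coheight_eq_of_smoothOfRelativeDimension ((baseChangeHom σ).obj W₀).hom
      (d + q) f
    by_contra hlt
    push Not at hlt
    have hfin : Order.coheight f ≠ ⊤ := (hlt.trans (ENat.coe_lt_top d)).ne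
    obtain ⟨b, hb⟩ := ENat.ne_top_iff_exists.mp hfin
    have hafin : Order.height f ≠ ⊤ := (hle.trans_lt (ENat.coe_lt_top q)).ne
    obtain ⟨a, ha⟩ := ENat.ne_top_iff_exists.mp hafin
    rw [← ha, ← hb] at hsum
    rw [← ha] at hle
    rw [← hb] at hlt
    have h1 : a + b = d + q := by exact_mod_cast hsum
    have h2 : a ≤ q := by exact_mod_cast hle
    have h3 : b < d := by exact_mod_cast hlt
    omega
  -- `F'` is a smooth projective variety of dimension `q`
  have hF' : IsSmoothProjective q F' := by
    haveI := hsmF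
    haveI : IsReduced F'.left := Motives.isReduced_of_smoothOfRelativeDimension F'.hom q
    haveI : IrreducibleSpace F'.left := by
      refine (irreducibleSpace_def _).mpr ?_
      have h := IsIrreducible.preimage_of_isInducing i.isClosedEmbedding.isInducing
        (hri ▸ hFi) subset_rfl
      rwa [Set.preimage_range, ← Set.top_eq_univ] at h
    haveI : IsIntegral F'.left := isIntegral_of_irreducibleSpace_of_isReduced _
    haveI := geometricallyIntegral_of_isAlgClosed F'.hom
    obtain ⟨n, κ, hκ⟩ := hW.isProjectiveOver
    haveI := hκ
    exact { smoothOfRelativeDimension := hsmF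
            isProjectiveOver := ⟨n, i' ≫ κ, inferInstanceAs (IsClosedImmersion (i ≫ κ.left))⟩
            geometricallyIrreducible := inferInstance }
  -- a complex point of `F ∩ g⁻¹O'`, at which `F → X` is immersive
  haveI : LocallyOfFiniteType F'.hom := by
    haveI := hsmF
    haveI : Smooth F'.hom := SmoothOfRelativeDimension.smooth q _
    infer_instance
  have hne : (i.base ⁻¹' (g.left.base ⁻¹' (O' : Set _))).Nonempty := by
    obtain ⟨f₀, hf₀⟩ := hFi.nonempty
    obtain ⟨f, hfF, hfO⟩ := closure_nonempty_iff.mp ⟨f₀, hdense hf₀⟩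
    rw [← hri] at hfF
    obtain ⟨f', rfl⟩ := hfF
    exact ⟨f', hfO⟩
  obtain ⟨P, hP⟩ := exists_ratPoint_pt_mem_of_isOpen F'
    ((O'.2.preimage g.left.continuous).preimage i.continuous) hne
  have hPO : g.left.base (i.base P.pt) ∈ (O' : Set _) := hP
  -- stalk surjectivity of `F' → X` at `P`
  have hsurj₁ : Function.Surjective ((i ≫ g.left).stalkMap P.pt) := by
    rw [Scheme.Hom.stalkMap_comp]
    have hgs : Function.Surjective (g.left.stalkMap (i.base P.pt)) :=
      surjective_of_arrow_iso (morphismRestrictStalkMap g.left O' ⟨i.base P.pt, hPO⟩)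
        ((g.left ∣_ O').stalkMap_surjective _)
    have his : Function.Surjective (i.stalkMap P.pt) := i.stalkMap_surjective _
    exact his.comp hgs
  have hsurj : Function.Surjective ((i' ≫ g ≫ fst _ _).left.stalkMap P.pt) := by
    have hcomp : (i' ≫ g ≫ fst _ _).left = j := by
      change i ≫ (g ≫ fst _ _).left = j
      rw [Over.comp_left, ← Category.assoc, hij, Category.assoc, ← Over.comp_left, sliceAt_fst]
      exact Category.comp_id _
    rw [hcomp]
    rw [hij, Scheme.Hom.stalkMap_comp] at hsurj₁
    exact Function.Surjective.of_comp hsurj₁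
  -- the spread class
  exact exists_spreadClass_of_resolution μ hX hT hW hF' (p := p) (by omega) hd (by omega) h𝒱 g
    hrange.subset t hFc hFi hFd subset_rfl i' hri.subset P hsurj

/-- **Codimension of the special `K`-slices over the smooth locus.** With the notation of
`exists_resolvedFamily`, for a `K`-point `w` of `T₀` in the smooth locus `V₀` of `W₀ → T₀`, every
point of `X = X₀ ⊗_σ ℂ` lying over the slice `i_w⁻¹ g₀(W₀) ⊆ X₀` has codimension `≥ p`: such a
slice is the image of the smooth `q`-dimensional fibre `(W₀)_w`, `q + p = m`, dimension does not
increase under morphisms and is preserved by the closed immersion `i_w`, `dim + codim = m` on `X₀`,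
and codimension does not drop along the flat projection `X → X₀`.
[cite: Hartshorne1977, II Ex. 3.20, II Ex. 3.22 and III Prop. 9.5] -/
theorem forall_le_coheight_of_sliceAt_mem_range {m q p : ℕ} {X₀ T₀ W₀ : SchemeOver K}
    (hX : IsSmoothProjective m ((baseChangeHom σ).obj X₀)) (hqp : q + p = m)
    [LocallyOfFiniteType T₀.hom] [LocallyOfFiniteType W₀.hom]
    (g₀ : W₀ ⟶ X₀ ⊗ T₀) (V₀ : T₀.left.Opens)
    [SmoothOfRelativeDimension q ((g₀ ≫ snd X₀ T₀).left ∣_ V₀)] (w : AlgPoints T₀ K)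
    (hw : w.pt ∈ V₀) :
    ∀ x ∈ (baseChangeHomFst σ X₀).base ⁻¹'
      ((sliceAt X₀ w).left.base ⁻¹' Set.range g₀.left.base), (p : ℕ∞) ≤ Order.coheight x := by
  have hX₀ : IsSmoothProjective m X₀ := isSmoothProjective_of_baseChangeHom σ X₀ hX
  haveI := hX₀.smoothOfRelativeDimension
  haveI := hX.smoothOfRelativeDimension
  haveI := IsSmoothProjective.isIntegral_holds hX₀
  haveI : LocallyOfFiniteType X₀.hom := by
    haveI : Smooth X₀.hom := SmoothOfRelativeDimension.smooth m _
    infer_instance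
  haveI : LocallyOfFiniteType (X₀ ⊗ T₀).hom := by
    change LocallyOfFiniteType (pullback.fst X₀.hom T₀.hom ≫ X₀.hom)
    infer_instance
  haveI : LocallyOfFiniteType g₀.left := by
    have hc : g₀.left ≫ (X₀ ⊗ T₀).hom = W₀.hom := Over.w g₀
    haveI : LocallyOfFiniteType (g₀.left ≫ (X₀ ⊗ T₀).hom) := by rw [hc]; infer_instance
    exact locallyOfFiniteType_of_comp g₀.left (X₀ ⊗ T₀).hom
  haveI := IsSmoothProjective.isLocallyNoetherian_holds hX
  haveI := (isLocallyNoetherian_of_isSmoothProjective_baseChangeHom σ hX).2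
  haveI : IsClosedImmersion (sliceAt X₀ w).left := isClosedImmersion_sliceAt_left w
  haveI : Subsingleton ↥(Spec (CommRingCat.of K)) := inferInstanceAs (Subsingleton (PrimeSpectrum K))
  obtain ⟨hflat, -⟩ := flat_surjective_of_isPullback_specMap (L := ℂ) (Field.toIsField K)
    (baseChangeHomFst σ X₀) ((baseChangeHom σ).obj X₀).hom X₀.hom (CommRingCat.ofHom σ)
    (IsPullback.of_hasPullback X₀.hom (Spec.map (CommRingCat.ofHom σ)))
  haveI := hflat
  rintro x ⟨c, hc⟩
  -- `c ∈ W₀` lies over `w`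
  have hcw : (g₀ ≫ snd X₀ T₀).left.base c = w.pt := by
    change (snd X₀ T₀).left.base (g₀.left.base c) = _
    rw [hc]
    change (sliceAt X₀ w ≫ snd X₀ T₀).left.base _ = _
    rw [sliceAt_snd]
    change w.left.base (X₀.hom.base _) = w.left.base (IsLocalRing.closedPoint K)
    rw [Subsingleton.elim (X₀.hom.base _) (IsLocalRing.closedPoint K)]
  have h1 : Order.height c ≤ q :=
    height_le_of_smoothOfRelativeDimension_morphismRestrict (g₀ ≫ snd X₀ T₀) V₀ (q := q) w hw hcw
  have h2 : Order.height (g₀.left.base c) ≤ Order.height c := by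
    rw [Motives.Scheme.height_eq_height_add_height_asFiber g₀.left (X₀ ⊗ T₀).hom c]
    exact le_self_add
  have h3 : Order.height ((baseChangeHomFst σ X₀).base x) ≤ q := by
    rw [← Motives.Scheme.height_base_eq_of_isClosedImmersion (sliceAt X₀ w).left, ← hc]
    exact h2.trans h1
  have hsum := height_add_coheight_eq_of_smoothOfRelativeDimension X₀.hom m
    ((baseChangeHomFst σ X₀).base x)
  have h4 : (p : ℕ∞) ≤ Order.coheight ((baseChangeHomFst σ X₀).base x) := by
    by_contra hlt
    push Not at hlt
    obtain ⟨b, hb⟩ := ENat.ne_top_iff_exists.mp (hlt.trans (ENat.coe_lt_top p)).ne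
    obtain ⟨a, ha⟩ := ENat.ne_top_iff_exists.mp (h3.trans_lt (ENat.coe_lt_top q)).ne
    rw [← ha, ← hb] at hsum
    rw [← ha] at h3
    rw [← hb] at hlt
    have e1 : a + b = m := by exact_mod_cast hsum
    have e2 : a ≤ q := by exact_mod_cast h3
    have e3 : b < p := by exact_mod_cast hlt
    omega
  exact h4.trans (coheight_base_le_of_flat (baseChangeHomFst σ X₀) x)

end ComplexSide

/-! ### Transcendental elements -/

section Transcendental

open Cardinal

/-- A field of cardinality `> ℵ₀` contains an element transcendental over any countable subfield
(the algebraic elements form a countable set, Mathlib `Algebra.IsAlgebraic.cardinalMk_le_max`).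
[folklore] -/
theorem exists_transcendental_of_countable {K L : Type u} [Field K] [Field L] [Algebra K L]
    (hK : #K ≤ ℵ₀) (hL : ℵ₀ < #L) : ∃ x : L, Transcendental K x := by
  by_contra h
  push Not at h
  haveI : Algebra.IsAlgebraic K L := ⟨fun x ↦ by
    have := h x
    unfold Transcendental at this
    push Not at this
    exact this⟩
  have hle := Algebra.IsAlgebraic.cardinalMk_le_max K L
  have : #L ≤ ℵ₀ := hle.trans (max_le hK le_rfl)
  exact (this.trans_lt hL).false

end Transcendental

/-! ### Assembly: the spread class exists, and the discharge -/

section Final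

open Cardinal

/-- There is a complex number transcendental over `σ(ℚ̄)`. [folklore] -/
theorem exists_transcendental_qbar (σ : AlgebraicClosure ℚ →+* ℂ) :
    letI := σ.toAlgebra; ∃ x : ℂ, Transcendental (AlgebraicClosure ℚ) x := by
  letI := σ.toAlgebra
  refine exists_transcendental_of_countable ?_ ?_
  · have h := @Algebra.IsAlgebraic.cardinalMk_le_max ℚ _ _ (AlgebraicClosure ℚ) _ _
      (AlgebraicClosure.instAlgebra ℚ) _ (AlgebraicClosure.isAlgebraic ℚ)
    calc #(AlgebraicClosure ℚ) ≤ max #ℚ ℵ₀ := h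
      _ = ℵ₀ := by rw [Cardinal.mk_eq_aleph0 ℚ, max_self]
  · rw [Cardinal.mk_complex]
    exact Cardinal.aleph0_lt_continuum

/-- **The spread class (hypothesis `hA` of
`charlesSchnell2014_algebraicClasses_supportedOn_qbarClosed_of_spreadClass`).** For `X = X₀ ⊗_σ ℂ`
smooth projective and an irreducible Zariski-closed `V ⊆ X` of codimension `p ≥ 1`: the generic
parameter `T₀`, `t` (`exists_generic_parameter`), the `ℚ̄`-closed family
`𝒱₀ = closure {Φ_t(η_V)} ⊆ X₀ ⊗ T₀` whose slice over `t` is `V`, its resolution over `ℚ̄`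
(`exists_resolvedFamily`), the class `κ = g_* 1` dying off `𝒱 = 𝒱₀ ⊗ ℂ` with `i_t^* κ ≠ 0`
(`exists_spreadClass_of_groundFamily`), and the open `U₀ ⊆ T₀` of good `ℚ̄`-slices
(`forall_le_coheight_of_sliceAt_mem_range`). This is the geometric half of Charles–Schnell's remark
("spread out `Z` to a flat family `𝒵 ⊂ X × Y` over a variety `Y` over `k` … the fiber `𝒵_y` at
every closed point `y ∈ Y(k)`"). [cite: CharlesSchnell2014Notes, Remark after Cor. 11.3.16]
[cite: Fulton1998, §10.1 and Example 19.1.10] -/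
theorem spreadClass_exists (μ : OrientationFamily) (σ : AlgebraicClosure ℚ →+* ℂ) ⦃m : ℕ⦄
    (X₀ : SchemeOver (AlgebraicClosure ℚ)) (hX : IsSmoothProjective m ((baseChangeHom σ).obj X₀))
    (p : ℕ) (V : Set ((baseChangeHom σ).obj X₀).left) (hVc : IsClosed V)
    (hV : IsIrreducible V) (hη : Order.coheight hV.genericPoint = p) :
    ∃ (d : ℕ) (T₀ : SchemeOver (AlgebraicClosure ℚ))
      (_ : IsSmoothProjective d ((baseChangeHom σ).obj T₀))
      (𝒱₀ : Set (X₀ ⊗ T₀).left) (_ : IsClosed 𝒱₀)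
      (e : (baseChangeHom σ).obj X₀ ⊗ (baseChangeHom σ).obj T₀ ≅
        (baseChangeHom σ).obj (X₀ ⊗ T₀))
      (_ : e.hom ≫ (baseChangeHom σ).map (fst X₀ T₀) = fst _ _)
      (_ : e.hom ≫ (baseChangeHom σ).map (snd X₀ T₀) = snd _ _)
      (t : Motives.ComplexPoints ((baseChangeHom σ).obj T₀))
      (κ : complexBetti ((baseChangeHom σ).obj X₀ ⊗ (baseChangeHom σ).obj T₀) (2 * p))
      (U₀ : Set T₀.left),
      (sliceAt ((baseChangeHom σ).obj X₀) t).left.base ⁻¹'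
          ((e.hom.left ≫ baseChangeHomFst σ (X₀ ⊗ T₀)).base ⁻¹' 𝒱₀) ⊆ V ∧
      complexBetti.restrictCompl ((baseChangeHom σ).obj X₀ ⊗ (baseChangeHom σ).obj T₀)
          ((e.hom.left ≫ baseChangeHomFst σ (X₀ ⊗ T₀)).base ⁻¹' 𝒱₀) (2 * p) κ = 0 ∧
      complexBetti.map (sliceAt ((baseChangeHom σ).obj X₀) t) (2 * p) κ ≠ 0 ∧
      IsOpen U₀ ∧ U₀.Nonempty ∧
      ∀ w : AlgPoints T₀ (AlgebraicClosure ℚ), w.pt ∈ U₀ →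
        ∀ x ∈ (baseChangeHomFst σ X₀).base ⁻¹' ((sliceAt X₀ w).left.base ⁻¹' 𝒱₀),
          (p : ℕ∞) ≤ Order.coheight x := by
  -- instances on `X`
  haveI := hX.smoothOfRelativeDimension
  haveI := IsSmoothProjective.isIntegral_holds hX
  haveI := IsSmoothProjective.isLocallyNoetherian_holds hX
  haveI := IsSmoothProjective.compactSpace_holds hX
  haveI : IsNoetherian ((baseChangeHom σ).obj X₀).left := {}
  have hX₀ : IsSmoothProjective m X₀ := isSmoothProjective_of_baseChangeHom σ X₀ hX
  haveI := hX₀.smoothOfRelativeDimension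
  haveI : LocallyOfFiniteType X₀.hom := by
    haveI : Smooth X₀.hom := SmoothOfRelativeDimension.smooth m _
    infer_instance
  -- the generic parameter
  have hVcpt : IsCompact Vᶜ := TopologicalSpace.NoetherianSpace.isCompact _
  obtain ⟨d, T₀, t, hd1, hT₀, hgen, hZ⟩ :=
    exists_generic_parameter σ (exists_transcendental_qbar σ) X₀ hVc hVcpt
  have hT : IsSmoothProjective d ((baseChangeHom σ).obj T₀) := IsSmoothProjective.baseChangeHom_holds σ hT₀
  haveI := IsSmoothProjective.isIntegral_holds hT₀
  haveI := hT₀.smoothOfRelativeDimension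
  haveI : LocallyOfFiniteType T₀.hom := by
    haveI : Smooth T₀.hom := SmoothOfRelativeDimension.smooth d _
    infer_instance
  obtain ⟨e, he₁, he₂⟩ := exists_tensorIso_baseChangeHom σ X₀ T₀
  obtain ⟨Z, hZc, hVZ⟩ := hZ e he₁ he₂
  -- `Φ_t`, `ζ = Φ_t(η_V)`, `Z₀ = closure {ζ}`
  set Φ := ((sliceAt ((baseChangeHom σ).obj X₀) t).left ≫ e.hom.left ≫
    baseChangeHomFst σ (X₀ ⊗ T₀)) with hΦ
  have hηV : hV.genericPoint ∈ V := (hV.isGenericPoint_genericPoint hVc).mem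
  have hVZ₀ : V = Φ.base ⁻¹' closure {Φ.base hV.genericPoint} := by
    apply le_antisymm
    · have h1 : closure {hV.genericPoint} ⊆ Φ.base ⁻¹' closure {Φ.base hV.genericPoint} :=
        closure_minimal (Set.singleton_subset_iff.2 (subset_closure (Set.mem_singleton _)))
          (isClosed_closure.preimage Φ.continuous)
      rwa [hV.closure_genericPoint hVc] at h1
    · have hζZ : Φ.base hV.genericPoint ∈ Z := by rw [← Set.mem_preimage, ← hVZ]; exact hηV
      calc Φ.base ⁻¹' closure {Φ.base hV.genericPoint} ⊆ Φ.base ⁻¹' Z :=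
            Set.preimage_mono (closure_minimal (Set.singleton_subset_iff.2 hζZ) hZc)
        _ = V := hVZ.symm
  have ht : (baseChangeHomFst σ T₀).base t.pt = genericPoint T₀.left := hgen.eq (genericPoint_spec _)
  have hζp : Order.coheight (Φ.base hV.genericPoint) = p := by
    have hηgen : IsGenericPoint hV.genericPoint (Φ.base ⁻¹' closure {Φ.base hV.genericPoint}) := by
      rw [← hVZ₀]; exact hV.isGenericPoint_genericPoint hVc
    rw [← hη]
    exact coheight_sliceProjection_apply_eq σ X₀ T₀ t ht e he₁ he₂ hηgen
  have hpm : p ≤ m := by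
    have hsum := height_add_coheight_eq_of_smoothOfRelativeDimension ((baseChangeHom σ).obj X₀).hom
      m hV.genericPoint
    rw [hη] at hsum
    have : (p : ℕ∞) ≤ m := by rw [← hsum]; exact le_add_self
    exact_mod_cast this
  have hΦsnd : Φ ≫ (snd X₀ T₀).left =
      ((baseChangeHom σ).obj X₀).hom ≫ t.left ≫ baseChangeHomFst σ T₀ :=
    sliceAt_comp_baseChangeHomFst_comp_snd σ X₀ T₀ t e he₂
  haveI : Subsingleton ↥(Spec (CommRingCat.of ℂ)) := inferInstanceAs (Subsingleton (PrimeSpectrum ℂ))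
  have hζsnd : (snd X₀ T₀).left.base (Φ.base hV.genericPoint) = (baseChangeHomFst σ T₀).base t.pt := by
    change (Φ ≫ (snd X₀ T₀).left).base hV.genericPoint = _
    rw [hΦsnd]
    change (baseChangeHomFst σ T₀).base (t.left.base (((baseChangeHom σ).obj X₀).hom.base
      hV.genericPoint)) = (baseChangeHomFst σ T₀).base (t.left.base (IsLocalRing.closedPoint ℂ))
    rw [Subsingleton.elim (((baseChangeHom σ).obj X₀).hom.base hV.genericPoint)
      (IsLocalRing.closedPoint ℂ)]
  have hζT : IsGenericPoint ((snd X₀ T₀).left.base (Φ.base hV.genericPoint)) (⊤ : Set T₀.left) := by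
    rw [hζsnd]; exact hgen
  -- the resolved family over `ℚ̄`
  obtain ⟨q, W₀, g₀, O, V₀, hW₀, hqp, hci, hζO, hrg₀, hζV₀, hsm⟩ :=
    exists_resolvedFamily hX₀ hT₀ (Φ.base hV.genericPoint) hζp hpm hζT
  haveI := hci
  haveI := hsm
  haveI := hW₀.smoothOfRelativeDimension
  haveI : LocallyOfFiniteType W₀.hom := by
    haveI : Smooth W₀.hom := SmoothOfRelativeDimension.smooth (d + q) _
    infer_instance
  have hVΦ : V = Φ.base ⁻¹' Set.range g₀.left.base := by rw [hrg₀]; exact hVZ₀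
  have htV₀ : (baseChangeHomFst σ T₀).base t.pt ∈ V₀ := by rw [← hζsnd]; exact hζV₀
  -- the class
  obtain ⟨κ, hκ, hκt⟩ := exists_spreadClass_of_groundFamily σ μ hX hT₀ hW₀ hqp hd1 g₀
    (hrg₀ ▸ isClosed_closure) O V₀ e he₂ t htV₀ hgen hV hVc hVΦ hζO
  refine ⟨d, T₀, hT, Set.range g₀.left.base, hrg₀ ▸ isClosed_closure, e, he₁, he₂, t, κ,
    (V₀ : Set T₀.left), ?_, hκ, hκt, V₀.2, ⟨_, hζV₀⟩, fun w hw ↦ ?_⟩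
  · have hV' : V = (sliceAt ((baseChangeHom σ).obj X₀) t).left.base ⁻¹'
        ((e.hom.left ≫ baseChangeHomFst σ (X₀ ⊗ T₀)).base ⁻¹' Set.range g₀.left.base) := by
      rw [hVΦ]; rfl
    rw [← hV']
  · exact forall_le_coheight_of_sliceAt_mem_range σ hX hqp g₀ V₀ w hw

/-- **Discharge of `charlesSchnell2014_algebraicClasses_supportedOn_qbarClosed`** (Charles–Schnell,
Remark after Cor. 11.3.16: "the conclusion of the corollary [that the class of an algebraic cycle is
supported on a closed `ℚ̄`-subvariety of the right codimension] is true for all algebraic cycles",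
via spreading out over `ℚ̄` and "the cycle class of `𝒵_y` is the same for every closed point
`y ∈ Y(k)`", Fulton, *Intersection Theory*, §10.1/§19.1 and Example 19.1.10): the reduction to the
spread class (`charlesSchnell2014_algebraicClasses_supportedOn_qbarClosed_of_spreadClass`, the
topological half) applied to `spreadClass_exists` (the geometric half).
[cite: CharlesSchnell2014Notes, Remark after Cor. 11.3.16] [cite: Fulton1998, §19.1 and Example 19.1.10] -/
theorem charlesSchnell2014_algebraicClasses_supportedOn_qbarClosed_holds :
    charlesSchnell2014_algebraicClasses_supportedOn_qbarClosed :=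
  charlesSchnell2014_algebraicClasses_supportedOn_qbarClosed_of_spreadClass
    fun σ _ X₀ hX p _ V hVc hV _ hη _ _ _ ↦
      spreadClass_exists (fun _ _ h ↦ Classical.choice (Motives.ComplexPoints.isOrientableOver ℂ h))
        σ X₀ hX p V hVc hV hη

end Final








end Literature.AlgebraicGeometry.HodgeTheory

end
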